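import Summits.QuantumFields.BalabanUV.T4Continuum.Spine.NE4.AutonomousSchemeSpectral
import Summits.QuantumFields.BalabanUV.T4Continuum.Spine.NE4.AutonomousSchemeAnalytic
import Summits.QuantumFields.BalabanUV.T4Continuum.Spine.NE4.AutonomousSchemeCurrency

/-!
# Spine/NE4/AutonomousSchemeClosed — (R45) ∘ (R46): the autonomous road's input list with NEITHER an invariant set NOR a modulus posited, as ONE named datum

Cell `pub-balaban-gaps` (YM blitz G2), seat `ne4`, generation 11; record `HOME/ne/NE4.md` §5 (R45)∕(R46), §8.  HONEST FRAMING as in the other `AutonomousScheme*`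
files: hypothesis shapes about an ABSTRACT one-step map; NE4 (`T4CouplingMatching.ScaleShiftRate`, NOT IN PRINT — [Balaban1987RG1] = CMP **109** p. 264) is NOT proved;
nothing of Bałaban's is asserted; no status word moves.  One finite T⁴; NOT ℝ⁴, NOT infinite volume, NOT a mass gap, NOT Clay.

THE POINT.  `AutonomousSchemeSpectral.invariant_gaugeBall` derives the invariant set (S) from a small source GIVEN the defect on the gauge ball;
`AutonomousSchemeAnalytic.linearDefect_of_stateAnalytic` derives the defect (N) on the NORM ball `closedBall 0 R₀` from state analyticity; the gauge ball of radius
`R₀` lies inside that norm ball (`gaugeBall_subset_closedBall`).  Composing (§1): `invariant_gaugeBall_of_stateAnalytic`, `ne4_closed` — node U2's β-side triple from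
{ONE contracting power of `T₀.restrictScalars ℝ`, STATE ANALYTICITY with a sup bound on `ball 0 ϱ₀`, the linearisation `a·g`-close to `T₀` at the bare state `0`, a SOURCE
bound `‖A g 0‖ ≤ s` balanced against the gap, coupling-Lipschitz and read-out constants on the gauge ball} — no invariant set, no modulus among the inputs.  §2: the read-out
of [Balaban1987RG1] (1.20)–(1.22) is LINEAR in the new term, so for a bounded linear read-out `r : E →L[ℝ] ℝ` the shape `ReadLipschitzOn r S ‖r‖` is automatic
(`readLipschitzOn_of_clm`).  §3 ONE NAME for the planners: the structure `AutonomousRoad A T₀ r β` bundles the numerical data and the six hypothesis shapes of the closed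
list; `AutonomousRoad.ne4` returns node U2's triple and `AutonomousRoad.scaleShiftRate` NE4 proper; `AutonomousRoad.injectedRate_relAnalytic` gives node U2's OUTPUT in the
log currency when the coupling dependence is supplied as RELATIVE analytic charts ((R47) `CouplingAnalyticRelState`) instead of a g-uniform Lipschitz constant.
-/

namespace Summit.QuantumFields.BalabanUV.T4Continuum.Spine.NE4

open Literature.MathematicalPhysics.QuantumFieldTheory.Balaban1983to89
open Literature.MathematicalPhysics.QuantumFieldTheory.Balaban1983to89.FlowStep
open Literature.MathematicalPhysics.QuantumFieldTheory.Balaban1983to89.T4CouplingMatching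
  (ScaleShiftRate HistLipschitz FadingMemory disc)
open Literature.MathematicalPhysics.QuantumFieldTheory.Balaban1983to89.T4SpectralRenewal (Kc Kc_nonneg)
open Metric Set

namespace Markov

/-! ## §1 The composition: invariant gauge ball and node U2's triple from analytic data + a small source -/

section Closed

variable {E : Type*} [NormedAddCommGroup E] [NormedSpace ℂ E] {A : ℝ → E → E} {T₀ : E →L[ℂ] E}
  {r : E → ℝ} {β : HBeta} {ϱ₀ M₀ a γ ϱ R₀ θ' s ℓ cr : ℝ} {N : ℕ}

/-- **THE INVARIANT GAUGE BALL FROM ANALYTIC DATA AND A SMALL SOURCE**: power hypothesis on `T₀.restrictScalars ℝ`, state analyticity + sup bound, linearisation shape,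
source `FirstStep A 0 s γ`, and the balance `Kc·s + (θ′ + Kc·anDefect)·R₀ ≤ R₀` ⟹ `Invariant A (gaugeBall (T₀.restrictScalars ℝ) θ′ N R₀) γ`. [folklore] -/
theorem invariant_gaugeBall_of_stateAnalytic (hθ : 0 < θ') (hN : 1 ≤ N) (hT : ‖(T₀.restrictScalars ℝ) ^ N‖ ≤ θ' ^ N)
    (hϱ₀ : 0 < ϱ₀) (hR : 0 ≤ R₀) (h3 : 3 * R₀ < ϱ) (hϱle : ϱ ≤ ϱ₀) (ha : 0 ≤ a) (hγ : 0 ≤ γ) (hM : 0 ≤ M₀)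
    (h : StateAnalytic A ϱ₀ M₀ γ) (hlin : LinearizationNear A T₀ a γ) (hsrc : FirstStep A 0 s γ)
    (hbal : Kc (T₀.restrictScalars ℝ) θ' N * s
      + (θ' + Kc (T₀.restrictScalars ℝ) θ' N * anDefect M₀ ϱ₀ a γ ϱ R₀) * R₀ ≤ R₀) :
    Invariant A (gaugeBall (T₀.restrictScalars ℝ) θ' N R₀) γ :=
  invariant_gaugeBall hθ hN hT
    ((linearDefect_of_stateAnalytic hϱ₀ hR h3 hϱle ha h hlin).mono (gaugeBall_subset_closedBall _ hθ.le hN R₀))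
    (anDefect_nonneg hM ha hγ (by linarith) (by linarith)) hsrc hR hbal

/-- **NE4 ∕ NODE U2's β-SIDE TRIPLE — THE AUTONOMOUS ROAD's CLOSED INPUT LIST** (census (R45) ∘ (R46)): with `K = Kc (T₀.restrictScalars ℝ) θ′ N` and
`ρ = θ′ + K·anDefect M₀ ϱ₀ a γ ϱ R₀`, the inputs {`‖(T₀.restrictScalars ℝ) ^ N‖ ≤ θ′ ^ N` [Gaussian; or spectral], `StateAnalytic A ϱ₀ M₀ γ` + `LinearizationNear A T₀ a γ`
[the ONE analyticity-domain statement], `FirstStep A 0 s γ` with `K·s + ρ·R₀ ≤ R₀` [source small against the gap], coupling-Lipschitz `ℓ` and read-out `cr` on the gauge ball,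
`3R₀ < ϱ ≤ ϱ₀`} give `ScaleShiftRate (cr·K·s·ρ) ρ γ β ∧ HistLipschitz Λ γ β ∧ FadingMemory (cr·K·ℓ) ρ Λ`.  NO invariant set and NO modulus among the hypotheses.
HYPOTHESES ONLY about an abstract scheme; NE4 for Bałaban's β is NOT proved. [folklore] -/
theorem ne4_closed (hθ : 0 < θ') (hN : 1 ≤ N) (hT : ‖(T₀.restrictScalars ℝ) ^ N‖ ≤ θ' ^ N)
    (hϱ₀ : 0 < ϱ₀) (hR : 0 ≤ R₀) (h3 : 3 * R₀ < ϱ) (hϱle : ϱ ≤ ϱ₀) (ha : 0 ≤ a) (hγ : 0 ≤ γ) (hM : 0 ≤ M₀)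
    (h : StateAnalytic A ϱ₀ M₀ γ) (hlin : LinearizationNear A T₀ a γ) (hsrc : FirstStep A 0 s γ)
    (hbal : Kc (T₀.restrictScalars ℝ) θ' N * s
      + (θ' + Kc (T₀.restrictScalars ℝ) θ' N * anDefect M₀ ϱ₀ a γ ϱ R₀) * R₀ ≤ R₀)
    (hlip : StateCouplingLipschitz A (gaugeBall (T₀.restrictScalars ℝ) θ' N R₀) ℓ γ) (hcr : 0 ≤ cr) (hℓ : 0 ≤ ℓ)
    (hrep : RepresentsAut A r 0 γ β) (hr : ReadLipschitzOn r (gaugeBall (T₀.restrictScalars ℝ) θ' N R₀) cr) :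
    ScaleShiftRate (cr * Kc (T₀.restrictScalars ℝ) θ' N * s *
        (θ' + Kc (T₀.restrictScalars ℝ) θ' N * anDefect M₀ ϱ₀ a γ ϱ R₀))
      (θ' + Kc (T₀.restrictScalars ℝ) θ' N * anDefect M₀ ϱ₀ a γ ϱ R₀) γ β ∧
    HistLipschitz (fun k i => cr * Kc (T₀.restrictScalars ℝ) θ' N * ℓ *
        (θ' + Kc (T₀.restrictScalars ℝ) θ' N * anDefect M₀ ϱ₀ a γ ϱ R₀) ^ (k - i)) γ β ∧
    FadingMemory (cr * Kc (T₀.restrictScalars ℝ) θ' N * ℓ) (θ' + Kc (T₀.restrictScalars ℝ) θ' N * anDefect M₀ ϱ₀ a γ ϱ R₀)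
      (fun k i => cr * Kc (T₀.restrictScalars ℝ) θ' N * ℓ *
        (θ' + Kc (T₀.restrictScalars ℝ) θ' N * anDefect M₀ ϱ₀ a γ ϱ R₀) ^ (k - i)) :=
  ne4_of_gaugeBall hθ hN hT
    ((linearDefect_of_stateAnalytic hϱ₀ hR h3 hϱle ha h hlin).mono (gaugeBall_subset_closedBall _ hθ.le hN R₀))
    (anDefect_nonneg hM ha hγ (by linarith) (by linarith)) hsrc hR hbal hlip hcr hℓ hrep hr

end Closed

/-! ## §2 The read-out: a bounded LINEAR read-out is Lipschitz with its operator norm on every set -/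

section ReadOut

variable {F : Type*} [NormedAddCommGroup F] [NormedSpace ℝ F]

/-- **A BOUNDED LINEAR READ-OUT IS LIPSCHITZ ON EVERY SET** with constant `‖r‖`: `ReadLipschitzOn r S ‖r‖` for `r : F →L[ℝ] ℝ` — the read-out (1.20)–(1.22) of
[Balaban1987RG1] p. 264 is a linear functional of the new term (the cell's kernel recipe (R)), so on the autonomous road the read-out constant `cr` is an operator
norm, not an extra modulus. [folklore] -/
theorem readLipschitzOn_of_clm (r : F →L[ℝ] ℝ) (S : Set F) : ReadLipschitzOn (fun x => r x) S ‖r‖ := by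
  intro x _ x' _
  rw [← Real.norm_eq_abs, ← map_sub, dist_eq_norm]
  exact r.le_opNorm (x - x')

end ReadOut

/-! ## §3 ONE NAME: the closed input list of the autonomous road as a structure, and NE4 ∕ node U2's triple from it -/

section Road

variable {E : Type*} [NormedAddCommGroup E] [NormedSpace ℂ E]

/-- [shape] **THE AUTONOMOUS ROAD's CLOSED INPUT LIST AS ONE DATUM** (all fields HYPOTHESIS SHAPES about an abstract scheme `A` on a complex Banach-type state space with
bare state `0`, a complex-linear reference operator `T₀` and a read-out `r`; NOT instantiated on Bałaban's objects; NOT a fact): a contracting power of the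
linearisation (`power`), state analyticity with a sup bound (`analytic`), the linearisation `a·g`-close to `T₀` at the bare state (`linNear`), a one-step source bound
(`source`) balanced against the gap (`balance`), a coupling-Lipschitz constant and a read-out constant on the gauge ball (`coupling`, `readOut`), and the representation of `β`
(`represents`). [folklore] -/
structure AutonomousRoad (A : ℝ → E → E) (T₀ : E →L[ℂ] E) (r : E → ℝ) (β : HBeta) where
  /-- depth of the contracting power -/
  N : ℕ
  /-- rate of the contracting power, analyticity radius and bound, linearisation slope, coupling box, working radii, source, coupling and read-out constants -/
  (θ' ϱ₀ M₀ a γ ϱ R₀ s ℓ cr : ℝ)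
  hθ : 0 < θ'
  hN : 1 ≤ N
  power : ‖(T₀.restrictScalars ℝ) ^ N‖ ≤ θ' ^ N
  hϱ₀ : 0 < ϱ₀
  hR : 0 ≤ R₀
  h3 : 3 * R₀ < ϱ
  hϱle : ϱ ≤ ϱ₀
  ha : 0 ≤ a
  hγ : 0 ≤ γ
  hM : 0 ≤ M₀
  hcr : 0 ≤ cr
  hℓ : 0 ≤ ℓ
  analytic : StateAnalytic A ϱ₀ M₀ γ
  linNear : LinearizationNear A T₀ a γ
  source : FirstStep A 0 s γ
  balance : Kc (T₀.restrictScalars ℝ) θ' N * s + (θ' + Kc (T₀.restrictScalars ℝ) θ' N * anDefect M₀ ϱ₀ a γ ϱ R₀) * R₀ ≤ R₀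
  coupling : StateCouplingLipschitz A (gaugeBall (T₀.restrictScalars ℝ) θ' N R₀) ℓ γ
  readOut : ReadLipschitzOn r (gaugeBall (T₀.restrictScalars ℝ) θ' N R₀) cr
  represents : RepresentsAut A r 0 γ β

namespace AutonomousRoad

variable {A : ℝ → E → E} {T₀ : E →L[ℂ] E} {r : E → ℝ} {β : HBeta}

/-- The adapted constant of the road. [folklore] -/
noncomputable def K (d : AutonomousRoad A T₀ r β) : ℝ := Kc (T₀.restrictScalars ℝ) d.θ' d.N

/-- The rate delivered by the road: `θ′ + K·anDefect`. [folklore] -/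
noncomputable def rate (d : AutonomousRoad A T₀ r β) : ℝ := d.θ' + d.K * anDefect d.M₀ d.ϱ₀ d.a d.γ d.ϱ d.R₀

/-- **NODE U2's β-SIDE TRIPLE FROM THE ROAD DATUM** (`ne4_closed` by name): `ScaleShiftRate (cr·K·s·rate) rate γ β ∧ HistLipschitz Λ γ β ∧ FadingMemory (cr·K·ℓ) rate Λ`.
HYPOTHESES ONLY; NE4 for Bałaban's β is NOT proved. [folklore] -/
theorem ne4 (d : AutonomousRoad A T₀ r β) :
    ScaleShiftRate (d.cr * d.K * d.s * d.rate) d.rate d.γ β ∧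
    HistLipschitz (fun k i => d.cr * d.K * d.ℓ * d.rate ^ (k - i)) d.γ β ∧
    FadingMemory (d.cr * d.K * d.ℓ) d.rate (fun k i => d.cr * d.K * d.ℓ * d.rate ^ (k - i)) :=
  ne4_closed d.hθ d.hN d.power d.hϱ₀ d.hR d.h3 d.hϱle d.ha d.hγ d.hM d.analytic d.linNear d.source d.balance d.coupling
    d.hcr d.hℓ d.represents d.readOut

/-- **NE4 PROPER FROM THE ROAD DATUM.** [folklore] -/
theorem scaleShiftRate (d : AutonomousRoad A T₀ r β) : ScaleShiftRate (d.cr * d.K * d.s * d.rate) d.rate d.γ β := d.ne4.1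

/-- The invariant class is OUTPUT of the road datum. [folklore] -/
theorem invariant (d : AutonomousRoad A T₀ r β) : Invariant A (gaugeBall (T₀.restrictScalars ℝ) d.θ' d.N d.R₀) d.γ :=
  invariant_gaugeBall_of_stateAnalytic d.hθ d.hN d.power d.hϱ₀ d.hR d.h3 d.hϱle d.ha d.hγ d.hM d.analytic d.linNear d.source d.balance

/-- The rate delivered by the road is positive. [folklore] -/
theorem rate_pos (d : AutonomousRoad A T₀ r β) : 0 < d.rate :=
  lt_of_lt_of_le d.hθ (le_add_of_nonneg_right (mul_nonneg (Kc_nonneg _ d.hθ.le _)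
    (anDefect_nonneg d.hM d.ha d.hγ (by linarith [d.hR, d.h3]) (by linarith [d.hR, d.h3]))))

/-- Orbit stability on the gauge ball is OUTPUT of the road datum (constant `K`, rate `rate`). [folklore] -/
theorem orbitStability (d : AutonomousRoad A T₀ r β) : OrbitStability A (gaugeBall (T₀.restrictScalars ℝ) d.θ' d.N d.R₀) d.K d.rate d.γ :=
  orbitStability_of_linearDefect d.hθ d.hN d.power d.invariant
    ((linearDefect_of_stateAnalytic d.hϱ₀ d.hR d.h3 d.hϱle d.ha d.analytic d.linNear).mono (gaugeBall_subset_closedBall _ d.hθ.le d.hN d.R₀))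
    (anDefect_nonneg d.hM d.ha d.hγ (by linarith [d.hR, d.h3]) (by linarith [d.hR, d.h3]))

/-- **NODE U2's OUTPUT FROM THE ROAD DATUM WITH RELATIVE ANALYTIC CHARTS IN THE COUPLING** (census (R47) `injectedRate_of_stable_relAnalytic` on the road's gauge ball): the
coupling-Lipschitz field of the datum is NOT used — instead `CouplingAnalyticRelState A (gaugeBall …) ρc M γ` (discs `|ζ − g| < ρc·g`, oscillation ≤ M), IR-pinned runs of
(0.20) in ]0,γ] (`γ > 0`), a target rate `ρ′ ∈ ]rate, 1[` and the log-currency window `cr·K·(M∕ρc)·(γ²∕2)·ρ′∕(ρ′ − rate) ≤ (1 − ρ′)∕2` give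
`InjectedRate (2·cr·K·s·rate∕(1 − ρ′)) 0 ρ′`.  NO `EventualLowerH`, NO g-uniform Lipschitz constant.  HYPOTHESES ONLY. [folklore] -/
theorem injectedRate_relAnalytic (d : AutonomousRoad A T₀ r β) {ρc M ρ' : ℝ} (g : ℕ → ℕ → ℝ) (gIR : ℝ)
    (hγ : 0 < d.γ) (hρc : 0 < ρc) (hMc : 0 ≤ M) (hρ'1 : ρ' < 1) (hρ' : d.rate < ρ')
    (han : CouplingAnalyticRelState A (gaugeBall (T₀.restrictScalars ℝ) d.θ' d.N d.R₀) ρc M d.γ)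
    (hrun : ∀ K, RGEqH K β (g K)) (hbox : ∀ K i, i ≤ K → 0 < g K i ∧ g K i ≤ d.γ) (hpin : ∀ K, g K K = gIR)
    (hsmall : d.cr * d.K * (M / ρc) * (d.γ ^ 2 / 2) * (ρ' / (ρ' - d.rate)) ≤ (1 - ρ') / 2) :
    T4CauchySum.InjectedRate (2 * (d.cr * d.K * d.s * d.rate) / (1 - ρ')) 0 ρ' (fun K j => disc (g K) (g (K + 1)) j) := by
  have hs : 0 ≤ d.s := le_trans (norm_nonneg _) (by
    have h := d.source d.γ hγ le_rfl
    rwa [dist_zero_right] at h)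
  exact injectedRate_of_stable_relAnalytic g gIR hγ hρc hMc hρ'1 d.rate_pos hρ' (Kc_nonneg _ d.hθ.le _) d.hcr hs
    d.invariant (zero_mem_gaugeBall _ _ _ d.hR) d.orbitStability han d.source d.represents d.readOut hrun hbox hpin hsmall

end AutonomousRoad

end Road

end Markov

end Summit.QuantumFields.BalabanUV.T4Continuum.Spine.NE4
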